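import Summits.QuantumFields.QCD.Theorems.GaussianLinkFramesFrameFMClosureTwoStarOfPaddedAux6
import Summits.QuantumFields.QCD.Theorems.GaussianLinkFramesPadTheFibreDefs

/-!
# Crux `GaussianLinkFrames.FrameFMClosure` (stmt-QuantumFields-17375), line `pad-the-fibre`, stub
`stub_twoStarOfPadded` — helper 9: the (univ) placement hypothesis of the region-wise two-star package from PADDED
cofactor domination on large tori

The region-generic re-run (`PadTheFibreTwoStar.twoStarBounds_of_placements`, helpers 1–8) consumes cofactor domination
through three placement families — (univ) `A = univ`, (sides) even boxes and complements, (collar) — all on tori with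
`4 ≤ S`.  This file discharges the FIRST from `PadTheFibre.PaddedCofactorDominationLarge` (the line's stub 1 after RESHAPE
gen 1: padded domination asked for `4 ≤ S` only): stars ∪ two full pads placed by `balanced_fullPads_univ` (helper 6), `≤ 2064`
links.  Worker-1 proof (`regionDom_univ_of_padded`), re-based on the landed Defs vocabulary
(`Theorems/GaussianLinkFramesPadTheFibreDefs.lean`) and the large-torus statement.
-/

noncomputable section

open scoped BigOperators
open MeasureTheory Filter
open Literature.MathematicalPhysics.QuantumFieldTheory Literature.MathematicalPhysics.QuantumLattice
  Literature.Probability.LatticeModels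
open Summit.QuantumFields.QCD.Theorems.VonMisesCircles Summit.QuantumFields.QCD.Theorems.PadTheFibre

namespace Summit.QuantumFields.QCD.Theorems.PadTheFibreTwoStar

/-- With no frozen layer (`M = ∅`) the full pad `padLinks S x'` is a canonical pad region about `x'`. [folklore] -/
theorem isPadRegion_padLinks {S : ℕ} (x' : TorusSite 4 (2 * S + 1)) : IsPadRegion S x' (padLinks S x') := by
  classical
  refine ⟨∅, fun _ => 0, fun μ hμ => (Finset.notMem_empty μ hμ).elim, ?_, ?_⟩
  · exact Finset.filter_subset _ _
  · intro e he
    rw [Finset.mem_filter]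
    refine ⟨he, fun h => ?_⟩
    have : e.1 ∉ padFrozen S x' ∅ (fun _ => 0) := by simp [padFrozen]
    exact this h.1

/-- **The (univ) placement hypothesis of the region-wise two-star package, from padded cofactor domination on large
tori**: for every probe mass in `[-9,1]`, every `S ≥ 4` and all `x, y` some region of `≤ 2064` links (stars ∪ two full
pads, placed by `balanced_fullPads_univ`) dominates the `(x,y)` adjugate block of `D` along its fibre over every outside
field. [folklore] -/
theorem univPlacement_of_paddedLarge : PaddedCofactorDominationLarge →
    ∃ Cu : ℝ, 0 < Cu ∧ ∀ (m₀ : ℝ), -9 ≤ m₀ → m₀ ≤ 1 → ∀ (S : ℕ), 4 ≤ S →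
      ∀ (x y : TorusSite 4 (2 * S + 1)),
      ∃ R : Finset (Edge 4 (2 * S + 1)), R.card ≤ 2064 ∧
        ∀ U W : GaugeConfig 4 (2 * S + 1) (Matrix.specialUnitaryGroup (Fin 3) ℂ),
          blockNorm ((sideMatrix Finset.univ (wilsonD (fun e => if e ∈ R then W e else U e) m₀)).adjugate) x y ≤
            Cu * ⨆ W' : GaugeConfig 4 (2 * S + 1) (Matrix.specialUnitaryGroup (Fin 3) ℂ),
              ‖(sideMatrix Finset.univ (wilsonD (fun e => if e ∈ R then W' e else U e) m₀)).det‖ := by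
  rintro ⟨C₀, hC₀, h⟩
  refine ⟨C₀, hC₀, fun m₀ hm₁ hm₂ S hS x y => ?_⟩
  refine regionDom_univ_of_fullPadDom hS m₀ C₀ hC₀.le ?_ x y
  intro U x y x' y' hx hy hbal W
  exact h m₀ hm₁ hm₂ S hS U Finset.univ (Or.inl rfl) x y (Finset.mem_univ _) (Finset.mem_univ _) x' y' hx hy
    (padLinks S x') (padLinks S y') (isPadRegion_padLinks x') (isPadRegion_padLinks y') hbal W

end Summit.QuantumFields.QCD.Theorems.PadTheFibreTwoStar

end
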